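import Summits.RiemannHypothesis.RiemannHypothesis.Theorems.HandoffSemilocalParitySplit
import Summits.RiemannHypothesis.RiemannHypothesis.Theorems.SemilocalDeletionDipole
import HarnessLib

/-!
# The TWO-BLOCK SANDWICH for semi-local ground energies (the theorem side of the ζ-null-space compression law)

Numerics of the `rh-explicit` cell (lineage E, seat cc-s2-1 gen14; HOME/cc-s2-1/gen14/PAIRWINDOW-LAW.md §6–§8, two sealed
blind files, 66 certified cells): the bottom `ε₁(U∖T; b)` of a prime-DELETED semi-local form on a large window is reproduced to
`≤ 5e−3` (typically `1e−5`) by the bottom `π` of the deleted form COMPRESSED to the near-null directions of the undeleted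
(`ζ`-pinned) window form — «the arithmetic enters only through which directions of the window are `ζ`-null».

This file proves the SHAPE of that law for EVERY semi-local form `Q_S` (any finite set of primes `S`, any window, any
constraint): split the test space into two `L²`-orthogonal blocks `g = v + w`; if

  `Re Q_S(v) ≥ m₁‖v‖₂²`,   `Re Q_S(w) ≥ m₂‖w‖₂²`,   `|Re C_S(v, w)| ≤ 2β‖v‖₂‖w‖₂`

(`C_S(v, w) = W_S(v ⋆ w̃) + W_S(w ⋆ ṽ)` the cross form of `HandoffSemilocalParitySplit.weilSemilocalQuadratic_add`), then

  `Re Q_S(v + w) ≥ λ₋(m₁, m₂, β)·‖v + w‖₂²`,  `λ₋(m₁, m₂, β) = (m₁ + m₂)/2 − √(((m₂ − m₁)/2)² + β²)`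

— the lower eigenvalue of the `2 × 2` matrix `[[m₁, β], [β, m₂]]` (§1: `λ₋ ≤ min(m₁, m₂)`, `(m₁ − λ₋)(m₂ − λ₋) = β²`,
`λ₋ ≥ m₁ − β²/(m₂ − m₁)` for `m₂ > m₁`, `λ₋(·, ·, 0) = min`).  Consequences (§4–§5):

* **compression sandwich** `twoBlockFloor_le_semilocalGroundEnergy`: if every admissible test function splits that way (block
  `V` = the compression space, `m₁ = π` its bottom, `m₂` = the floor of the form on the complement, `β` = the coupling) then
  `π − β²/(m₂ − π) ≤ λ₋ ≤ λ_min(S; c; P) ≤ π` (the upper end is Ritz, `semilocalGroundEnergy_le_re`): the compression DEFECT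
  `π − λ_min` is at most (coupling)²/(gap);
* **Temple form** (block `V` = ONE trial function `v`, `m₁ = Re Q_S(v)/‖v‖₂²`, `β‖w‖₂ ≥ |Re C_S(v,w)|/(2‖v‖₂)` = the residual
  coupling of `v`, `m₂` = the floor on `v^⊥`): `Re Q_S(v)/‖v‖₂² − β²/(m₂ − m₁) ≤ λ_min ≤ Re Q_S(v)/‖v‖₂²`;
* **two-sided CLIFF LAW** (§5, with `SemilocalDeletionDipole`): for `p ∈ S` and a block `h ∈ C(δ)`, `2δ < log p`, the deleted
  form's bottom on `C((log p)/2 + δ)` measured from the dipole floor, `Δ := λ_min(S∖{p}) + log p/√p`, satisfies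
  `λ₋(D, M, β) ≤ Δ ≤ D`, `D = Re Q_S(d_h)/‖d_h‖₂²` the dipole energy of the UNDELETED form, `M` the floor of the deleted
  form on `d_h^⊥` (from `−log p/√p`), `β` the residual coupling of the dipole: `0 ≤ D − Δ ≤ β²/(M − D)`.

These are statements about truncated Weil forms (Rayleigh-quotient algebra); nothing here bears on RH.  The finite sections of
lineage E are sub-spaces of the test space, so every inequality applies verbatim inside a section (where `m₂`, `β` are finite
computations); the continuum energy `semilocalGroundEnergy` enters only through `le_semilocalGroundEnergy` /
`semilocalGroundEnergy_le_re`.  SIZES (exploratory float anatomy, seat cc-s2-1 gen15, kit j223983, the 56 deleted cells of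
gen14's files 3–4 at `N = 400`): with block `1` = the `2ν` lowest directions of the window form, the complement floor `m₂` of
the DELETED form is `5.9…7.2` (`b = 3`), `2.9…3.6` (`47/20`), `1.4…1.8` (`b = 2`) — coercive off the near-null space — the
coupling is `β = 0.7…1.8`, and the sandwich `[λ₋, π]` has width `0.10…0.36 / 0.12…0.51 / 0.24…0.78`; in the Temple form
(block `1` = the compressed bottom vector alone, `β` = its residual `2e−4…0.16`) the width is `≤ 1e−3` in 22/56 cells and
`≤ 1e−2` in 36/56, the wide ones being the near-degenerate bottoms (`ε₂ − ε₁ ≲ r`).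
-/

set_option linter.dupNamespace false

noncomputable section

open Complex Filter Set MeasureTheory
open scoped Real Topology ComplexConjugate

namespace Summit.RiemannHypothesis.RiemannHypothesis.Theorems.SemilocalDeletionCompression

open Literature.NumberTheory.LFunctions
open Summit.RiemannHypothesis.RiemannHypothesis.Theorems.HandoffSemilocalEnergy
open Summit.RiemannHypothesis.RiemannHypothesis.Theorems.HandoffSemilocalParitySplit
open Summit.RiemannHypothesis.RiemannHypothesis.Theorems.SemilocalDeletionDipole

/-! ## §1  The lower eigenvalue of a real symmetric `2 × 2` matrix -/

variable {m₁ m₂ β a b : ℝ}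

-- Throughout, `λ₋(m₁, m₂, β) := (m₁ + m₂)/2 − √(((m₂ − m₁)/2)² + β²)` (the lower eigenvalue of `[[m₁, β], [β, m₂]]`) is written
-- OUT IN FULL in every statement (no definition, no notation), so that each theorem is a closed formula in `m₁, m₂, β`.

/-- The discriminant is nonnegative. -/
theorem disc_nonneg (m₁ m₂ β : ℝ) : 0 ≤ ((m₂ - m₁) / 2) ^ 2 + β ^ 2 := by positivity

/-- Symmetry in the two diagonal entries. -/
theorem twoBlockFloor_comm (m₁ m₂ β : ℝ) :
    ((m₁ + m₂) / 2 - Real.sqrt (((m₂ - m₁) / 2) ^ 2 + β ^ 2)) = ((m₂ + m₁) / 2 - Real.sqrt (((m₁ - m₂) / 2) ^ 2 + β ^ 2)) := by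
  rw [show ((m₁ - m₂) / 2) ^ 2 = ((m₂ - m₁) / 2) ^ 2 by ring, add_comm m₂ m₁]

/-- Only `β²` matters. -/
theorem twoBlockFloor_neg (m₁ m₂ β : ℝ) :
    ((m₁ + m₂) / 2 - Real.sqrt (((m₂ - m₁) / 2) ^ 2 + (-β) ^ 2)) = ((m₁ + m₂) / 2 - Real.sqrt (((m₂ - m₁) / 2) ^ 2 + β ^ 2)) := by
  rw [neg_sq]

/-- Translation covariance: `λ₋(m₁ + t, m₂ + t, β) = λ₋(m₁, m₂, β) + t`. -/
theorem twoBlockFloor_add (m₁ m₂ β t : ℝ) :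
    (((m₁ + t) + (m₂ + t)) / 2 - Real.sqrt ((((m₂ + t) - (m₁ + t)) / 2) ^ 2 + β ^ 2)) =
      ((m₁ + m₂) / 2 - Real.sqrt (((m₂ - m₁) / 2) ^ 2 + β ^ 2)) + t := by
  rw [show (m₂ + t - (m₁ + t)) / 2 = (m₂ - m₁) / 2 by ring]
  ring

/-- `λ₋ ≤ m₁`. -/
theorem twoBlockFloor_le_left (m₁ m₂ β : ℝ) : ((m₁ + m₂) / 2 - Real.sqrt (((m₂ - m₁) / 2) ^ 2 + β ^ 2)) ≤ m₁ := by
  have h : |(m₂ - m₁) / 2| ≤ Real.sqrt (((m₂ - m₁) / 2) ^ 2 + β ^ 2) :=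
    Real.abs_le_sqrt (by nlinarith [sq_nonneg β])
  have := le_abs_self ((m₂ - m₁) / 2)
  linarith

/-- `λ₋ ≤ m₂`. -/
theorem twoBlockFloor_le_right (m₁ m₂ β : ℝ) : ((m₁ + m₂) / 2 - Real.sqrt (((m₂ - m₁) / 2) ^ 2 + β ^ 2)) ≤ m₂ := by
  rw [twoBlockFloor_comm]
  exact twoBlockFloor_le_left m₂ m₁ β

/-- The characteristic equation: `(m₁ − λ₋)(m₂ − λ₋) = β²`. -/
theorem sub_twoBlockFloor_mul (m₁ m₂ β : ℝ) :
    (m₁ - ((m₁ + m₂) / 2 - Real.sqrt (((m₂ - m₁) / 2) ^ 2 + β ^ 2))) *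
      (m₂ - ((m₁ + m₂) / 2 - Real.sqrt (((m₂ - m₁) / 2) ^ 2 + β ^ 2))) = β ^ 2 := by
  have hs := Real.sq_sqrt (disc_nonneg m₁ m₂ β)
  linear_combination hs

/-- Without coupling the floor is the smaller diagonal entry: `λ₋(m₁, m₂, 0) = min(m₁, m₂)`. -/
theorem twoBlockFloor_zero (m₁ m₂ : ℝ) : ((m₁ + m₂) / 2 - Real.sqrt (((m₂ - m₁) / 2) ^ 2 + (0:ℝ) ^ 2)) = min m₁ m₂ := by
  rw [sq (0:ℝ), mul_zero, add_zero, Real.sqrt_sq_eq_abs]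
  rcases le_total m₁ m₂ with h | h
  · rw [min_eq_left h, abs_of_nonneg (by linarith)]
    ring
  · rw [min_eq_right h, abs_of_nonpos (by linarith)]
    ring

/-- **The `2 × 2` Rayleigh bound**: `λ₋·(a² + b²) ≤ m₁a² − 2βab + m₂b²` for all real `a`, `b` (the quadratic form of
`[[m₁, −β], [−β, m₂]]` is bounded below by its lower eigenvalue; `(m₁ − λ₋)X = ((m₁ − λ₋)a − βb)²`). -/
theorem twoBlockFloor_mul_le (m₁ m₂ β a b : ℝ) :
    ((m₁ + m₂) / 2 - Real.sqrt (((m₂ - m₁) / 2) ^ 2 + β ^ 2)) * (a ^ 2 + b ^ 2) ≤ m₁ * a ^ 2 - 2 * β * a * b + m₂ * b ^ 2 := by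
  set l := ((m₁ + m₂) / 2 - Real.sqrt (((m₂ - m₁) / 2) ^ 2 + β ^ 2)) with hl
  have hp : 0 ≤ m₁ - l := sub_nonneg.2 (twoBlockFloor_le_left _ _ _)
  have hq : 0 ≤ m₂ - l := sub_nonneg.2 (twoBlockFloor_le_right _ _ _)
  have hpq : (m₁ - l) * (m₂ - l) = β ^ 2 := sub_twoBlockFloor_mul _ _ _
  have e : m₁ * a ^ 2 - 2 * β * a * b + m₂ * b ^ 2 - l * (a ^ 2 + b ^ 2) =
      (m₁ - l) * a ^ 2 - 2 * β * a * b + (m₂ - l) * b ^ 2 := by ring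
  suffices key : 0 ≤ (m₁ - l) * a ^ 2 - 2 * β * a * b + (m₂ - l) * b ^ 2 by linarith
  rcases hp.eq_or_lt with hp0 | hp0
  · have hβ0 : β = 0 := by
      have : β ^ 2 = 0 := by rw [← hpq, ← hp0, zero_mul]
      exact pow_eq_zero_iff two_ne_zero |>.1 this
    rw [← hp0, hβ0]
    nlinarith [hq, sq_nonneg b]
  · have hsq : 0 ≤ ((m₁ - l) * a - β * b) ^ 2 := sq_nonneg _
    have he : ((m₁ - l) * a - β * b) ^ 2 = (m₁ - l) * ((m₁ - l) * a ^ 2 - 2 * β * a * b + (m₂ - l) * b ^ 2) := by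
      linear_combination (-(b ^ 2)) * hpq
    rw [he] at hsq
    exact (mul_nonneg_iff_of_pos_left hp0).1 hsq

/-- **The explicit lower end**: for `m₂ > m₁`, `m₁ − β²/(m₂ − m₁) ≤ λ₋(m₁, m₂, β)` — the floor is the block-`1` bottom minus at
most (coupling)²/(gap). -/
theorem sub_div_le_twoBlockFloor (h : m₁ < m₂) (β : ℝ) :
    m₁ - β ^ 2 / (m₂ - m₁) ≤ ((m₁ + m₂) / 2 - Real.sqrt (((m₂ - m₁) / 2) ^ 2 + β ^ 2)) := by
  have hd : 0 < m₂ - m₁ := sub_pos.2 h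
  have hR : 0 ≤ (m₂ - m₁) / 2 + β ^ 2 / (m₂ - m₁) := by positivity
  have hsq : ((m₂ - m₁) / 2 + β ^ 2 / (m₂ - m₁)) ^ 2 = ((m₂ - m₁) / 2) ^ 2 + β ^ 2 + (β ^ 2 / (m₂ - m₁)) ^ 2 := by
    field_simp
    ring
  have key : Real.sqrt (((m₂ - m₁) / 2) ^ 2 + β ^ 2) ≤ (m₂ - m₁) / 2 + β ^ 2 / (m₂ - m₁) := by
    calc Real.sqrt (((m₂ - m₁) / 2) ^ 2 + β ^ 2)
        ≤ Real.sqrt (((m₂ - m₁) / 2 + β ^ 2 / (m₂ - m₁)) ^ 2) :=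
          Real.sqrt_le_sqrt (by rw [hsq]; nlinarith [sq_nonneg (β ^ 2 / (m₂ - m₁))])
      _ = (m₂ - m₁) / 2 + β ^ 2 / (m₂ - m₁) := Real.sqrt_sq hR
  linarith

/-- Monotonicity in the diagonal entries: `m₁ ≤ m₁'`, `m₂ ≤ m₂'` ⇒ `λ₋(m₁, m₂, β) ≤ λ₋(m₁', m₂', β)` (a larger symmetric matrix
has a larger bottom; proved through the Rayleigh characterisation). -/
theorem twoBlockFloor_mono {m₁' m₂' : ℝ} (h₁ : m₁ ≤ m₁') (h₂ : m₂ ≤ m₂') (β : ℝ) :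
    ((m₁ + m₂) / 2 - Real.sqrt (((m₂ - m₁) / 2) ^ 2 + β ^ 2)) ≤
      ((m₁' + m₂') / 2 - Real.sqrt (((m₂' - m₁') / 2) ^ 2 + β ^ 2)) := by
  -- evaluate the smaller form on the bottom eigenvector `(a, b) = (m₂' − λ', β)` of the larger one, `λ' = λ₋(m₁', m₂', β)`
  set l' := ((m₁' + m₂') / 2 - Real.sqrt (((m₂' - m₁') / 2) ^ 2 + β ^ 2)) with hl'
  have hq' : 0 ≤ m₂' - l' := sub_nonneg.2 (twoBlockFloor_le_right _ _ _)
  have hpq' : (m₁' - l') * (m₂' - l') = β ^ 2 := sub_twoBlockFloor_mul _ _ _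
  rcases hq'.eq_or_lt with hq0 | hq0
  · -- `m₂' = λ'`: then `((m₁ + m₂) / 2 - Real.sqrt (((m₂ - m₁) / 2) ^ 2 + β ^ 2)) ≤ m₂ ≤ m₂' = λ'`
    have := twoBlockFloor_le_right m₁ m₂ β
    linarith
  · have hR := twoBlockFloor_mul_le m₁ m₂ β (m₂' - l') β
    -- the larger form at `(m₂' − λ', β)` equals `λ'·((m₂' − λ')² + β²)`
    have hval : m₁' * (m₂' - l') ^ 2 - 2 * β * (m₂' - l') * β + m₂' * β ^ 2 = l' * ((m₂' - l') ^ 2 + β ^ 2) := by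
      linear_combination (m₂' - l') * hpq'
    have hle : m₁ * (m₂' - l') ^ 2 - 2 * β * (m₂' - l') * β + m₂ * β ^ 2 ≤
        m₁' * (m₂' - l') ^ 2 - 2 * β * (m₂' - l') * β + m₂' * β ^ 2 := by
      nlinarith [sq_nonneg (m₂' - l'), sq_nonneg β]
    have hpos : 0 < (m₂' - l') ^ 2 + β ^ 2 := by positivity
    exact le_of_mul_le_mul_right (by linarith) hpos

/-! ## §2  `L²` bookkeeping for two test functions -/

variable {S : Finset ℕ} {v w g : ℝ → ℂ} {P : (ℝ → ℂ) → Prop} {c : ℝ}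

/-- `v · conj w` is integrable for test functions. -/
theorem integrable_mul_conj (hv : IsWeilTest v) (hw : IsWeilTest w) : Integrable fun t ↦ v t * conj (w t) :=
  hv.integrable_mul (Complex.continuous_conj.comp hw.1.continuous)

/-- Polarisation of the `L²` norm: `‖v + w‖₂² = ‖v‖₂² + ‖w‖₂² + 2 Re ⟨v, w⟩`, `⟨v, w⟩ = ∫ v conj w`. -/
theorem integral_norm_sq_add (hv : IsWeilTest v) (hw : IsWeilTest w) :
    ∫ t, ‖(v + w) t‖ ^ 2 = (∫ t, ‖v t‖ ^ 2) + (∫ t, ‖w t‖ ^ 2) + 2 * (∫ t, v t * conj (w t)).re := by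
  have e : (fun t ↦ ‖(v + w) t‖ ^ 2) = fun t ↦ (‖v t‖ ^ 2 + ‖w t‖ ^ 2) + 2 * (v t * conj (w t)).re := by
    funext t
    rw [Pi.add_apply, ← Complex.normSq_eq_norm_sq, ← Complex.normSq_eq_norm_sq, ← Complex.normSq_eq_norm_sq,
      Complex.normSq_add]
  have i1 := hv.integrable_norm_sq
  have i2 := hw.integrable_norm_sq
  have i3 := integrable_mul_conj hv hw
  have i12 : Integrable fun t ↦ ‖v t‖ ^ 2 + ‖w t‖ ^ 2 := i1.add i2
  have i3' : Integrable fun t ↦ 2 * (v t * conj (w t)).re := (i3.re).const_mul 2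
  have i4 : ∫ t, (v t * conj (w t)).re = (∫ t, v t * conj (w t)).re := by
    have := integral_re i3
    simpa only [RCLike.re_to_complex] using this
  rw [e, integral_add i12 i3', integral_add i1 i2, integral_const_mul, i4]

/-- Pythagoras: `⟨v, w⟩ = 0 ⇒ ‖v + w‖₂² = ‖v‖₂² + ‖w‖₂²`. -/
theorem integral_norm_sq_add_of_orthogonal (hv : IsWeilTest v) (hw : IsWeilTest w) (horth : ∫ t, v t * conj (w t) = 0) :
    ∫ t, ‖(v + w) t‖ ^ 2 = (∫ t, ‖v t‖ ^ 2) + ∫ t, ‖w t‖ ^ 2 := by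
  rw [integral_norm_sq_add hv hw, horth, Complex.zero_re, mul_zero, add_zero]

/-- `Re Q_S(v + w) = Re Q_S(v) + Re Q_S(w) + Re C_S(v, w)`. -/
theorem re_weilSemilocalQuadratic_add (S : Finset ℕ) (hv : IsWeilTest v) (hw : IsWeilTest w) :
    (weilSemilocalQuadratic S (v + w)).re = (weilSemilocalQuadratic S v).re + (weilSemilocalQuadratic S w).re +
      (weilSemilocalFunctional S (weilConv v (weilReflect w)) + weilSemilocalFunctional S (weilConv w (weilReflect v))).re := by
  have h := congrArg Complex.re (weilSemilocalQuadratic_add S hv hw)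
  simpa only [Complex.add_re] using h

/-! ## §3  The two-block sandwich at Rayleigh level -/

/-- **TWO-BLOCK LOWER BOUND.** For `L²`-orthogonal test functions `v`, `w` with `Re Q_S(v) ≥ m₁‖v‖₂²`, `Re Q_S(w) ≥ m₂‖w‖₂²`
and cross form `|Re C_S(v, w)| ≤ 2β‖v‖₂‖w‖₂` (`β ≥ 0`): `Re Q_S(v + w) ≥ λ₋(m₁, m₂, β)·‖v + w‖₂²`. -/
theorem twoBlockFloor_mul_le_re_weilSemilocalQuadratic (S : Finset ℕ) (hv : IsWeilTest v) (hw : IsWeilTest w)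
    (horth : ∫ t, v t * conj (w t) = 0)
    (h₁ : m₁ * ∫ t, ‖v t‖ ^ 2 ≤ (weilSemilocalQuadratic S v).re)
    (h₂ : m₂ * ∫ t, ‖w t‖ ^ 2 ≤ (weilSemilocalQuadratic S w).re)
    (hC : |(weilSemilocalFunctional S (weilConv v (weilReflect w)) + weilSemilocalFunctional S (weilConv w (weilReflect v))).re| ≤
      2 * β * Real.sqrt (∫ t, ‖v t‖ ^ 2) * Real.sqrt (∫ t, ‖w t‖ ^ 2)) :
    ((m₁ + m₂) / 2 - Real.sqrt (((m₂ - m₁) / 2) ^ 2 + β ^ 2)) * ∫ t, ‖(v + w) t‖ ^ 2 ≤ (weilSemilocalQuadratic S (v + w)).re := by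
  have hA0 : 0 ≤ ∫ t, ‖v t‖ ^ 2 := integral_nonneg fun _ ↦ by positivity
  have hB0 : 0 ≤ ∫ t, ‖w t‖ ^ 2 := integral_nonneg fun _ ↦ by positivity
  obtain ⟨a, ha0, ha2⟩ : ∃ a : ℝ, 0 ≤ a ∧ a ^ 2 = ∫ t, ‖v t‖ ^ 2 := ⟨_, Real.sqrt_nonneg _, Real.sq_sqrt hA0⟩
  obtain ⟨b, hb0, hb2⟩ : ∃ b : ℝ, 0 ≤ b ∧ b ^ 2 = ∫ t, ‖w t‖ ^ 2 := ⟨_, Real.sqrt_nonneg _, Real.sq_sqrt hB0⟩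
  have hsa : Real.sqrt (∫ t, ‖v t‖ ^ 2) = a := by rw [← ha2, Real.sqrt_sq ha0]
  have hsb : Real.sqrt (∫ t, ‖w t‖ ^ 2) = b := by rw [← hb2, Real.sqrt_sq hb0]
  rw [hsa, hsb] at hC
  rw [← ha2] at h₁
  rw [← hb2] at h₂
  rw [integral_norm_sq_add_of_orthogonal hv hw horth, re_weilSemilocalQuadratic_add S hv hw, ← ha2, ← hb2]
  have hX := twoBlockFloor_mul_le m₁ m₂ β a b
  have hcross := neg_abs_le
    (weilSemilocalFunctional S (weilConv v (weilReflect w)) + weilSemilocalFunctional S (weilConv w (weilReflect v))).re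
  linarith [hX, hcross, hC, h₁, h₂]

/-- The same with the explicit lower end: for `m₂ > m₁`, `Re Q_S(v + w) ≥ (m₁ − β²/(m₂ − m₁))·‖v + w‖₂²`. -/
theorem sub_div_mul_le_re_weilSemilocalQuadratic (S : Finset ℕ) (hv : IsWeilTest v) (hw : IsWeilTest w)
    (horth : ∫ t, v t * conj (w t) = 0) (hm : m₁ < m₂)
    (h₁ : m₁ * ∫ t, ‖v t‖ ^ 2 ≤ (weilSemilocalQuadratic S v).re)
    (h₂ : m₂ * ∫ t, ‖w t‖ ^ 2 ≤ (weilSemilocalQuadratic S w).re)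
    (hC : |(weilSemilocalFunctional S (weilConv v (weilReflect w)) + weilSemilocalFunctional S (weilConv w (weilReflect v))).re| ≤
      2 * β * Real.sqrt (∫ t, ‖v t‖ ^ 2) * Real.sqrt (∫ t, ‖w t‖ ^ 2)) :
    (m₁ - β ^ 2 / (m₂ - m₁)) * ∫ t, ‖(v + w) t‖ ^ 2 ≤ (weilSemilocalQuadratic S (v + w)).re := by
  have h := twoBlockFloor_mul_le_re_weilSemilocalQuadratic S hv hw horth h₁ h₂ hC
  have hN : 0 ≤ ∫ t, ‖(v + w) t‖ ^ 2 := integral_nonneg fun _ ↦ by positivity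
  exact (mul_le_mul_of_nonneg_right (sub_div_le_twoBlockFloor hm β) hN).trans h

/-! ## §4  In energy language: the compression sandwich `π − β²/(m₂ − π) ≤ λ_min(S; c; P) ≤ π` -/

/-- **COMPRESSION SANDWICH, lower end.**  Suppose every admissible test function of `(S, c, P)` (Weil test `g` on
`[−c, c]` with `P g`) SPLITS INTO TWO BLOCKS `g = v + w` with `v ⊥ w` in `L²`, `Re Q_S(v) ≥ m₁‖v‖₂²`, `Re Q_S(w) ≥ m₂‖w‖₂²` and
cross form `|Re C_S(v, w)| ≤ 2β‖v‖₂‖w‖₂` (block `1` = the compression space, `m₁ = π` its bottom; `m₂` = the floor of the form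
on the complement; `β` = the coupling).  Then `λ₋(m₁, m₂, β) ≤ λ_min(S; c; P)` (nonempty sphere). -/
theorem twoBlockFloor_le_semilocalGroundEnergy (hne : (semilocalSphereValues S P c).Nonempty)
    (hsplit : ∀ g : ℝ → ℂ, IsWeilTest g → tsupport g ⊆ Icc (-c) c → P g →
      ∃ v w : ℝ → ℂ, IsWeilTest v ∧ IsWeilTest w ∧ g = v + w ∧ (∫ t, v t * conj (w t) = 0) ∧
        m₁ * ∫ t, ‖v t‖ ^ 2 ≤ (weilSemilocalQuadratic S v).re ∧
        m₂ * ∫ t, ‖w t‖ ^ 2 ≤ (weilSemilocalQuadratic S w).re ∧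
        |(weilSemilocalFunctional S (weilConv v (weilReflect w)) + weilSemilocalFunctional S (weilConv w (weilReflect v))).re| ≤
          2 * β * Real.sqrt (∫ t, ‖v t‖ ^ 2) * Real.sqrt (∫ t, ‖w t‖ ^ 2)) :
    ((m₁ + m₂) / 2 - Real.sqrt (((m₂ - m₁) / 2) ^ 2 + β ^ 2)) ≤ semilocalGroundEnergy S P c := by
  refine le_semilocalGroundEnergy hne fun g hg hs hPg hn ↦ ?_
  obtain ⟨v, w, hv, hw, rfl, horth, h₁, h₂, hC⟩ := hsplit g hg hs hPg
  have h := twoBlockFloor_mul_le_re_weilSemilocalQuadratic S hv hw horth h₁ h₂ hC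
  rwa [hn, mul_one] at h

/-- **COMPRESSION SANDWICH, explicit**: under the same two-block splitting with `m₂ > m₁`,
`m₁ − β²/(m₂ − m₁) ≤ λ_min(S; c; P)` — the defect of the compressed bottom `m₁ = π` below the true bottom is at most
(coupling)²/(gap); the upper end `λ_min ≤ π` is Ritz (`semilocalGroundEnergy_le_re` on a normalised bottom vector of block `1`). -/
theorem sub_div_le_semilocalGroundEnergy (hne : (semilocalSphereValues S P c).Nonempty) (hm : m₁ < m₂)
    (hsplit : ∀ g : ℝ → ℂ, IsWeilTest g → tsupport g ⊆ Icc (-c) c → P g →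
      ∃ v w : ℝ → ℂ, IsWeilTest v ∧ IsWeilTest w ∧ g = v + w ∧ (∫ t, v t * conj (w t) = 0) ∧
        m₁ * ∫ t, ‖v t‖ ^ 2 ≤ (weilSemilocalQuadratic S v).re ∧
        m₂ * ∫ t, ‖w t‖ ^ 2 ≤ (weilSemilocalQuadratic S w).re ∧
        |(weilSemilocalFunctional S (weilConv v (weilReflect w)) + weilSemilocalFunctional S (weilConv w (weilReflect v))).re| ≤
          2 * β * Real.sqrt (∫ t, ‖v t‖ ^ 2) * Real.sqrt (∫ t, ‖w t‖ ^ 2)) :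
    m₁ - β ^ 2 / (m₂ - m₁) ≤ semilocalGroundEnergy S P c :=
  (sub_div_le_twoBlockFloor hm β).trans (twoBlockFloor_le_semilocalGroundEnergy hne hsplit)

/-- Without coupling the bottom is at least the smaller block floor: an `L²`-orthogonal splitting with VANISHING cross form
(e.g. the parity split of `HandoffSemilocalParitySplit`) and block floors `m₁`, `m₂` gives `min(m₁, m₂) ≤ λ_min(S; c; P)`. -/
theorem min_le_semilocalGroundEnergy_of_uncoupled (hne : (semilocalSphereValues S P c).Nonempty)
    (hsplit : ∀ g : ℝ → ℂ, IsWeilTest g → tsupport g ⊆ Icc (-c) c → P g →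
      ∃ v w : ℝ → ℂ, IsWeilTest v ∧ IsWeilTest w ∧ g = v + w ∧ (∫ t, v t * conj (w t) = 0) ∧
        m₁ * ∫ t, ‖v t‖ ^ 2 ≤ (weilSemilocalQuadratic S v).re ∧
        m₂ * ∫ t, ‖w t‖ ^ 2 ≤ (weilSemilocalQuadratic S w).re ∧
        (weilSemilocalFunctional S (weilConv v (weilReflect w)) + weilSemilocalFunctional S (weilConv w (weilReflect v))).re = 0) :
    min m₁ m₂ ≤ semilocalGroundEnergy S P c := by
  rw [← twoBlockFloor_zero]
  refine twoBlockFloor_le_semilocalGroundEnergy hne fun g hg hs hPg ↦ ?_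
  obtain ⟨v, w, hv, hw, hg', horth, h₁, h₂, hC⟩ := hsplit g hg hs hPg
  exact ⟨v, w, hv, hw, hg', horth, h₁, h₂, by rw [hC, abs_zero]; positivity⟩

/-! ## §5  The two-sided CLIFF LAW: `λ₋(D_h, M, β) ≤ λ_min(S∖{p}; (log p)/2 + δ; P) + log p/√p ≤ D_h` -/

variable {h : ℝ → ℂ} {δ : ℝ} {p : ℕ}

/-- The Rayleigh quotient of a multiple of the dipole `d_h` in the DELETED form, from the UNDELETED dipole energy:
`Re Q_{S∖{p}}(a·d_h) = (Re Q_S(d_h)/‖d_h‖₂² − log p/√p)·‖a·d_h‖₂²` (`p ∈ S` prime, `h ∈ C(δ)`, `2δ < log p`, `‖h‖₂ ≠ 0`). -/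
theorem re_weilSemilocalQuadratic_erase_const_mul_dipole (hh : IsWeilTest h) (hsupp : tsupport h ⊆ Icc (-δ) δ)
    (hp : p.Prime) (hpS : p ∈ S) (hδ : 2 * δ < Real.log p) (hh0 : 0 < ∫ u, ‖h u‖ ^ 2) (a : ℂ) :
    (weilSemilocalQuadratic (S.erase p) (fun t ↦ a * (h (t + Real.log p / 2) - h (t - Real.log p / 2)))).re =
      ((weilSemilocalQuadratic S (fun t ↦ h (t + Real.log p / 2) - h (t - Real.log p / 2))).re /
          (2 * ∫ u, ‖h u‖ ^ 2) - Real.log p / Real.sqrt p) *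
        ∫ t, ‖a * (h (t + Real.log p / 2) - h (t - Real.log p / 2))‖ ^ 2 := by
  have hn : ∫ t, ‖a * (h (t + Real.log p / 2) - h (t - Real.log p / 2))‖ ^ 2 =
      Complex.normSq a * (2 * ∫ u, ‖h u‖ ^ 2) := by
    rw [← integral_norm_sq_dipole hh hsupp hδ, ← integral_const_mul]
    congr 1 with t
    rw [norm_mul, mul_pow, Complex.normSq_eq_norm_sq]
  rw [weilSemilocalQuadratic_const_mul, Complex.re_ofReal_mul, re_weilSemilocalQuadratic_erase_dipole hh hsupp hp hpS hδ, hn]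
  have h2 : (∫ u, ‖h u‖ ^ 2) ≠ 0 := hh0.ne'
  generalize (weilSemilocalQuadratic S (fun t ↦ h (t + Real.log p / 2) - h (t - Real.log p / 2))).re = Q
  generalize (∫ u, ‖h u‖ ^ 2) = N at h2 ⊢
  field_simp

/-- **TWO-SIDED CLIFF LAW (Temple form on the dipole).**  `p ∈ S` prime, `h ∈ C(δ)` a block with `2δ < log p` and
`‖h‖₂ ≠ 0`, `D := Re Q_S(d_h)/‖d_h‖₂²` the dipole energy of the UNDELETED form.  If every admissible test function of
`(S∖{p}, (log p)/2 + δ, P)` splits as `a·d_h + w` with `w ⊥ d_h`, `Re Q_{S∖{p}}(w) ≥ (M − log p/√p)‖w‖₂²` and residual coupling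
`|Re C_{S∖{p}}(a·d_h, w)| ≤ 2β‖a·d_h‖₂‖w‖₂`, then `λ₋(D, M, β) − log p/√p ≤ λ_min(S∖{p}; (log p)/2 + δ; P)`; with the dipole
CEILING `semilocalGroundEnergy_erase_add_mul_le` (`λ_min + log p/√p ≤ D`) the cliff offset `Δ = λ_min + log p/√p` is
SANDWICHED: `λ₋(D, M, β) ≤ Δ ≤ D`, i.e. `0 ≤ D − Δ ≤ β²/(M − D)` for `M > D`. -/
theorem twoBlockFloor_dipole_le_semilocalGroundEnergy_erase (hh : IsWeilTest h) (hsupp : tsupport h ⊆ Icc (-δ) δ)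
    (hp : p.Prime) (hpS : p ∈ S) (hδ : 2 * δ < Real.log p) (hh0 : 0 < ∫ u, ‖h u‖ ^ 2) {D M : ℝ}
    (hD : D = (weilSemilocalQuadratic S (fun t ↦ h (t + Real.log p / 2) - h (t - Real.log p / 2))).re / (2 * ∫ u, ‖h u‖ ^ 2))
    (hne : (semilocalSphereValues (S.erase p) P (Real.log p / 2 + δ)).Nonempty)
    (hsplit : ∀ g : ℝ → ℂ, IsWeilTest g → tsupport g ⊆ Icc (-(Real.log p / 2 + δ)) (Real.log p / 2 + δ) → P g →
      ∃ (a : ℂ) (w : ℝ → ℂ), IsWeilTest w ∧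
        g = (fun t ↦ a * (h (t + Real.log p / 2) - h (t - Real.log p / 2))) + w ∧
        (∫ t, a * (h (t + Real.log p / 2) - h (t - Real.log p / 2)) * conj (w t) = 0) ∧
        (M - Real.log p / Real.sqrt p) * ∫ t, ‖w t‖ ^ 2 ≤ (weilSemilocalQuadratic (S.erase p) w).re ∧
        |(weilSemilocalFunctional (S.erase p)
              (weilConv (fun t ↦ a * (h (t + Real.log p / 2) - h (t - Real.log p / 2))) (weilReflect w)) +
            weilSemilocalFunctional (S.erase p)
              (weilConv w (weilReflect fun t ↦ a * (h (t + Real.log p / 2) - h (t - Real.log p / 2))))).re| ≤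
          2 * β * Real.sqrt (∫ t, ‖a * (h (t + Real.log p / 2) - h (t - Real.log p / 2))‖ ^ 2) *
            Real.sqrt (∫ t, ‖w t‖ ^ 2)) :
    (D + M) / 2 - Real.sqrt (((M - D) / 2) ^ 2 + β ^ 2) - Real.log p / Real.sqrt p ≤
      semilocalGroundEnergy (S.erase p) P (Real.log p / 2 + δ) := by
  set wp := Real.log p / Real.sqrt p with hwp
  have hshift : (D + M) / 2 - Real.sqrt (((M - D) / 2) ^ 2 + β ^ 2) - wp =
      ((D - wp) + (M - wp)) / 2 - Real.sqrt ((((M - wp) - (D - wp)) / 2) ^ 2 + β ^ 2) := by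
    rw [show (M - wp) - (D - wp) = M - D by ring]
    ring
  rw [hshift]
  refine twoBlockFloor_le_semilocalGroundEnergy hne fun g hg hs hPg ↦ ?_
  obtain ⟨a, w, hw, hgvw, horth, h₂, hC⟩ := hsplit g hg hs hPg
  have hd := (isWeilTest_dipole hh (Real.log p)).const_mul a
  refine ⟨_, w, hd, hw, hgvw, horth, le_of_eq ?_, h₂, hC⟩
  rw [re_weilSemilocalQuadratic_erase_const_mul_dipole hh hsupp hp hpS hδ hh0 a, hD]

/-- The explicit form of the lower end: under the hypotheses of `twoBlockFloor_dipole_le_semilocalGroundEnergy_erase` and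
`M > D`, `D − β²/(M − D) − log p/√p ≤ λ_min(S∖{p}; (log p)/2 + δ; P)` — the cliff offset `Δ` misses the undeleted dipole
energy `D` by at most (residual coupling)²/(gap). -/
theorem dipole_sub_div_le_semilocalGroundEnergy_erase (hh : IsWeilTest h) (hsupp : tsupport h ⊆ Icc (-δ) δ)
    (hp : p.Prime) (hpS : p ∈ S) (hδ : 2 * δ < Real.log p) (hh0 : 0 < ∫ u, ‖h u‖ ^ 2) {D M : ℝ}
    (hD : D = (weilSemilocalQuadratic S (fun t ↦ h (t + Real.log p / 2) - h (t - Real.log p / 2))).re / (2 * ∫ u, ‖h u‖ ^ 2))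
    (hM : D < M) (hne : (semilocalSphereValues (S.erase p) P (Real.log p / 2 + δ)).Nonempty)
    (hsplit : ∀ g : ℝ → ℂ, IsWeilTest g → tsupport g ⊆ Icc (-(Real.log p / 2 + δ)) (Real.log p / 2 + δ) → P g →
      ∃ (a : ℂ) (w : ℝ → ℂ), IsWeilTest w ∧
        g = (fun t ↦ a * (h (t + Real.log p / 2) - h (t - Real.log p / 2))) + w ∧
        (∫ t, a * (h (t + Real.log p / 2) - h (t - Real.log p / 2)) * conj (w t) = 0) ∧
        (M - Real.log p / Real.sqrt p) * ∫ t, ‖w t‖ ^ 2 ≤ (weilSemilocalQuadratic (S.erase p) w).re ∧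
        |(weilSemilocalFunctional (S.erase p)
              (weilConv (fun t ↦ a * (h (t + Real.log p / 2) - h (t - Real.log p / 2))) (weilReflect w)) +
            weilSemilocalFunctional (S.erase p)
              (weilConv w (weilReflect fun t ↦ a * (h (t + Real.log p / 2) - h (t - Real.log p / 2))))).re| ≤
          2 * β * Real.sqrt (∫ t, ‖a * (h (t + Real.log p / 2) - h (t - Real.log p / 2))‖ ^ 2) *
            Real.sqrt (∫ t, ‖w t‖ ^ 2)) :
    D - β ^ 2 / (M - D) - Real.log p / Real.sqrt p ≤ semilocalGroundEnergy (S.erase p) P (Real.log p / 2 + δ) := by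
  have h1 := twoBlockFloor_dipole_le_semilocalGroundEnergy_erase (P := P) hh hsupp hp hpS hδ hh0 hD hne hsplit
  have h2 := sub_div_le_twoBlockFloor hM β
  linarith

end Summit.RiemannHypothesis.RiemannHypothesis.Theorems.SemilocalDeletionCompression
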